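import Literature.Computability.Complexity.UniformDerandomizationMachine
import Literature.Computability.Complexity.UniformDerandomizationEquiv
import Literature.Computability.Complexity.BPPErrorReductionStrong
import HarnessLib

/-!
# The uniform distinguisher of the i.o. simulation (Trevisan–Vadhan 2007, Lemma 2.3: the test `T`)

Literature / complexity — second file of the discharge-in-progress of the named fact
`impagliazzoWigderson1998_samplable` (`UniformDerandomization.lean`; van Melkebeek 2000,
Thm. 6.2.1 = Impagliazzo–Wigderson 1998, Thm. 5). The simulation `UDerand.simLang`
(`UniformDerandomizationMachine.lean`) takes the majority vote of the `BPP` predicate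
`V(x, r) = [⟨x, r⟩ ∈ L₁]` over the outputs of a generator `G ℓ : {0,1}^{ℓ^{c₀}} → {0,1}^{ℓ^k}`.
Trevisan–Vadhan 2007, proof of Lemma 2.3: if the simulation errs with probability `≥ 1/n^c` under a
samplable distribution `D`, "Consider a randomized test `T` that, given `r`, samples `x ← Dₙ`,
picks `s` at random and outputs `1` iff `M(x; r) ≠ M(x; s)` … `T` has running time `poly(n)`.
This violates the pseudorandomness of `G`." This file builds that test in the tree's model and
computes its acceptance probability:

* `UDerand.seedAvg`, `UDerand.unifAvg` — the two averages compared by a UNIFORM distinguisher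
  `T : RandAlg (List Bool) Bool` fed `⟨1^ℓ, r⟩` (the acceptance probability over `T`'s own coins,
  averaged over the generator's outputs `G ℓ σ ↾ ℓ^k`, `σ ∈ {0,1}^{ℓ^{c₀}}`, resp. over
  `r ∈ {0,1}^{ℓ^k}`); the pseudorandomness hypothesis "`|seedAvg - unifAvg| < 1/ℓ^c` i.o., for every
  uniform PPT test and every `c`" (Trevisan–Vadhan 2007, §2.3) is written inline by the consumer;
* `UDerand.distinguisher L₁ q₁ S qS K k` — the test `T` for a sampler `S` with the exact
  polynomial coin budget `qS` (the printed sampler class of `impagliazzoWigderson1998`,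
  `UniformDerandomizationRandAlg.lean`): on `⟨1^ℓ, r⟩` with coins `c` (exactly
  `(qS + q₁)(N^K)` of them, `N = |⟨1^ℓ, r⟩|`), `n = ℓ^K`, `u = c ↾ qS(n)`, `s =` the next `q₁(n)`
  coins: sample `x = S(1ⁿ; u)` and answer `[V(x, r ↾ q₁(n)) ≠ V(x, s)]`. It is probabilistic
  polynomial time with an EXACT polynomial coin budget (`UDerand.distinguisher_isPolyTime`,
  `UDerand.distinguisher_coinLen_eq`: brick algebra, the sampler entering through `UDerand.sampleFn`
  of `UniformDerandomizationEquiv.lean`);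
* `UDerand.pr_distinguisher` — its acceptance probability on `⟨1^ℓ, r⟩`, `|r| = ℓ^k`:
  `E_u [ Pr_s [V(x_u, r↾q₁(n)) ≠ V(x_u, s)] ]` (prefix marginal + coin split `UDerand.cnt_split`).

## References

* L. Trevisan, S. Vadhan, *Pseudorandomness and average-case complexity via uniform reductions*,
  Comput. Complexity 16 (2007) 331–364, §2.3 (uniform distinguishers) and Lemma 2.3 (proof: the
  test `T`) [TrevisanVadhan2007].
* R. Impagliazzo, A. Wigderson, *Randomness vs time: derandomization under a uniform assumption*,
  JCSS 63 (2001) 672–688, Thm. 5 [ImpagliazzoWigderson2001].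
* D. van Melkebeek, *Randomness and Completeness in Computational Complexity*, LNCS 1950 (2000),
  Thm. 6.2.1 [VanMelkebeek2000].
* S. Arora, B. Barak, *Computational Complexity: A Modern Approach*, CUP 2009, Def. 20.2
  (pseudorandom generators), §7.1 (probabilistic machines as deterministic machines with coins)
  [AroraBarakCC2009].
-/

noncomputable section

namespace Literature.Computability.Complexity

open _root_.Computability Finset Filter Polynomial Brick Plumb MetaComplexity

namespace UDerand

/-! ### Counting lemmas: splitting the coins, prefix marginals -/

section Counting

open scoped Classical

/-- Coin strings of length `a + b` as pairs (first `a` coins, last `b` coins). [folklore] -/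
def splitEquiv (a b : ℕ) : List.Vector Bool (a + b) ≃ List.Vector Bool a × List.Vector Bool b where
  toFun c := (⟨c.toList.take a, by simp⟩, ⟨c.toList.drop a, by simp⟩)
  invFun p := p.1 ++ p.2
  left_inv c := List.Vector.eq _ _ (by
    rw [List.Vector.toList_append]
    exact List.take_append_drop a c.toList)
  right_inv p := by
    obtain ⟨u, v⟩ := p
    have hu : u.toList.length = a := u.toList_length
    refine Prod.ext (List.Vector.eq _ _ ?_) (List.Vector.eq _ _ ?_)
    · show List.take a (u ++ v).toList = u.toList
      rw [List.Vector.toList_append, List.take_left' hu]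
    · show List.drop a (u ++ v).toList = v.toList
      rw [List.Vector.toList_append, List.drop_left' hu]

/-- **Splitting the coins**: the strings of length `a + b` whose first `a` and last `b` symbols satisfy
`Q` are counted fibrewise, `cnt (a+b) {c | Q (c↾a) (c⇂a)} = Σ_{u ∈ {0,1}^a} cnt b {v | Q u v}`.
[cite: AroraBarakCC2009, §7.1 (independent coin blocks)] -/
theorem cnt_split (a b : ℕ) (Q : List Bool → List Bool → Prop) :
    cnt (a + b) {c | Q (c.take a) (c.drop a)} = ∑ u : List.Vector Bool a, cnt b {v | Q u.toList v} := by
  unfold cnt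
  simp only [card_eq_sum_ones, sum_filter, Set.mem_setOf_eq]
  rw [Fintype.sum_equiv (splitEquiv a b)
      (fun c : List.Vector Bool (a + b) => if Q (c.toList.take a) (c.toList.drop a) then 1 else 0)
      (fun p : List.Vector Bool a × List.Vector Bool b => if Q p.1.toList p.2.toList then 1 else 0)
      (fun c => rfl), Fintype.sum_prod_type]

/-- `uniformProb` only depends on the strings of length `m` in the event. [folklore] -/
theorem uniformProb_congr' {m : ℕ} {E E' : Set (List Bool)}
    (h : ∀ y : List Bool, y.length = m → (y ∈ E ↔ y ∈ E')) : uniformProb m E = uniformProb m E' := by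
  rw [uniformProb_eq_cnt_div, uniformProb_eq_cnt_div, cnt_congr h]

/-- **Splitting the coins, probability form**:
`Pr_{c ∈ {0,1}^{a+b}}[Q (c↾a) (c⇂a)] = E_{u ∈ {0,1}^a} Pr_{v ∈ {0,1}^b}[Q u v]`. [cite: AroraBarakCC2009, §7.1] -/
theorem uniformProb_split (a b : ℕ) (Q : List Bool → List Bool → Prop) :
    uniformProb (a + b) {c | Q (c.take a) (c.drop a)} =
      (∑ u : List.Vector Bool a, uniformProb b {v | Q u.toList v}) / 2 ^ a := by
  rw [uniformProb_eq_cnt_div, cnt_split, pow_add, Nat.cast_sum]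
  simp only [uniformProb_eq_cnt_div]
  rw [← sum_div, div_div, mul_comm]

/-- **Prefix marginal**: for `b ≤ N`, the strings `r ∈ {0,1}^N` whose (padded) prefix `r↾b` lies in `E`
number `2^{N-b} · cnt b E`. [cite: AroraBarakCC2009, §7.1] -/
theorem cnt_takeD_prefix {b N : ℕ} (h : b ≤ N) (E : Set (List Bool)) :
    cnt N {r | List.takeD b r false ∈ E} = 2 ^ (N - b) * cnt b E := by
  have hN : b + (N - b) = N := Nat.add_sub_cancel' h
  rw [← hN, cnt_congr (E' := {y | y.take b ∈ E ∧ y.drop b ∈ (Set.univ : Set (List Bool))}) (fun y hy => ?_),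
    cnt_take_drop, cnt_univ, Nat.add_sub_cancel_left, mul_comm]
  simp only [Set.mem_setOf_eq, Set.mem_univ, and_true]
  rw [List.takeD_eq_take _ (by omega)]

/-- Prefix marginal, probability form: `Pr_{r ∈ {0,1}^N}[r↾b ∈ E] = Pr_{y ∈ {0,1}^b}[y ∈ E]` (`b ≤ N`).
[cite: AroraBarakCC2009, §7.1] -/
theorem uniformProb_takeD_prefix {b N : ℕ} (h : b ≤ N) (E : Set (List Bool)) :
    uniformProb N {r | List.takeD b r false ∈ E} = uniformProb b E := by
  rw [uniformProb_eq_cnt_div, uniformProb_eq_cnt_div, cnt_takeD_prefix h, Nat.cast_mul, Nat.cast_pow,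
    Nat.cast_ofNat, show (2 : ℝ) ^ N = 2 ^ (N - b) * 2 ^ b by rw [← pow_add, Nat.sub_add_cancel h]]
  field_simp

/-- `uniformProb` as a fraction of bit vectors (stated for an arbitrary decidability instance of the
filter). [folklore] -/
theorem uniformProb_eq_card_filter (m : ℕ) (E : Set (List Bool))
    {inst : DecidablePred fun z : List.Vector Bool m => z.toList ∈ E} :
    uniformProb m E = ((@Finset.filter _ (fun z : List.Vector Bool m => z.toList ∈ E) inst univ).card : ℝ) / 2 ^ m := by
  rw [uniformProb_eq_cnt_div]
  unfold cnt
  congr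

/-- `uniformProb` as an average of an indicator over bit vectors. [folklore] -/
theorem uniformProb_eq_sum_ite (m : ℕ) (E : Set (List Bool)) :
    uniformProb m E = (∑ z : List.Vector Bool m, if z.toList ∈ E then (1 : ℝ) else 0) / 2 ^ m := by
  rw [uniformProb_eq_cnt_div]
  unfold cnt
  rw [sum_boole]

/-- **Averaging a two-valued function**: over `{0,1}^m`, the average of `z ↦ (W z ? A : B)` is
`q A + (1 - q) B`, `q` the fraction of `z` with `W z`. [folklore] -/
theorem avg_ite_eq (m : ℕ) (W : List.Vector Bool m → Prop) [DecidablePred W] (A B : ℝ) :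
    (∑ z : List.Vector Bool m, if W z then A else B) / 2 ^ m =
      ((univ.filter W).card : ℝ) / 2 ^ m * A + (1 - ((univ.filter W).card : ℝ) / 2 ^ m) * B := by
  have h2 : (0 : ℝ) < 2 ^ m := by positivity
  have hcard : ((univ.filter W).card : ℝ) + ((univ.filter fun z => ¬ W z).card : ℝ) = 2 ^ m := by
    have h := Finset.card_filter_add_card_filter_not (s := (univ : Finset (List.Vector Bool m))) W
    rw [card_univ, card_vector, Fintype.card_bool] at h
    exact_mod_cast h
  rw [sum_ite, sum_const, sum_const, nsmul_eq_mul, nsmul_eq_mul]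
  have hw' : (1 : ℝ) - ((univ.filter W).card : ℝ) / 2 ^ m = ((univ.filter fun z => ¬ W z).card : ℝ) / 2 ^ m := by
    rw [eq_div_iff h2.ne', sub_mul, div_mul_cancel₀ _ h2.ne', one_mul]
    linarith [hcard]
  rw [hw', add_div]
  ring

/-- Nested padded prefixes: `(l ↾↑ N) ↾↑ b = l ↾↑ b` for `b ≤ N` (`↾↑ = List.takeD · · false`). [folklore] -/
theorem takeD_takeD_of_le {b N : ℕ} (h : b ≤ N) (l : List Bool) :
    List.takeD b (List.takeD N l false) false = List.takeD b l false := by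
  induction b generalizing N l with
  | zero => rfl
  | succ b ih =>
    cases N with
    | zero => omega
    | succ N =>
      simp only [List.takeD_succ, List.head?_cons, Option.getD_some, List.tail_cons, ih (by omega : b ≤ N)]

end Counting

/-! ### Uniform distinguishers: the two averages, the hypotheses on the generator -/

section Hyp

variable (c₀ k : ℕ) (G : ℕ → List Bool → List Bool)

/-- **The pseudorandom average**: the acceptance probability of the test `T` (over its own coins) on
`⟨1^ℓ, G ℓ σ ↾ ℓ^k⟩`, averaged over the seeds `σ ∈ {0,1}^{ℓ^{c₀}}`.
[cite: TrevisanVadhan2007, §2.3 (`Pr[T(x, G(x)) = 1]`)] [cite: AroraBarakCC2009, Def. 20.2] -/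
def seedAvg (T : RandAlg (List Bool) Bool) (ℓ : ℕ) : ℝ :=
  (∑ σ : List.Vector Bool (ℓ ^ c₀),
    T.pr id (boolPair (ones ℓ) (List.takeD (ℓ ^ k) (G ℓ σ.toList) false)) {true}) / 2 ^ ℓ ^ c₀

/-- **The uniform average**: the acceptance probability of `T` on `⟨1^ℓ, r⟩`, averaged over
`r ∈ {0,1}^{ℓ^k}`. [cite: TrevisanVadhan2007, §2.3 (`Pr[T(x, U_{m}) = 1]`)] [cite: AroraBarakCC2009, Def. 20.2] -/
def unifAvg (T : RandAlg (List Bool) Bool) (ℓ : ℕ) : ℝ :=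
  (∑ r : List.Vector Bool (ℓ ^ k), T.pr id (boolPair (ones ℓ) r.toList) {true}) / 2 ^ ℓ ^ k

/-! The two hypotheses on the generator consumed by `UniformDerandomizationProofs.lean` are written
INLINE there (they are hypotheses of theorems, not named facts; D-0026): (1) *`G` is computable in time
`2^{ℓ^{c₀}} · poly`*, as polynomial time on the exponential pad (Arora–Barak 2009, §2.6.2) —
`∃ F ∈ FP, ∀ ℓ σ, |σ| = ℓ^{c₀} → F (1^{2^{ℓ^{c₀}}} 0 ⟨1^ℓ, σ⟩) = G ℓ σ`, the format consumed by
`UDerand.simLang`; (2) *`G` fools uniform probabilistic polynomial time infinitely often at every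
polynomial rate* (Trevisan–Vadhan 2007, §2.3: "`G` cannot be `1/m^c`-distinguished in time `m^c` for
any constant `c`", the hypothesis of their Lemma 2.3) — for every `T : RandAlg (List Bool) Bool` with
`T.IsPolyTime id encodeBool` AND an exactly polynomial coin budget (a uniform probabilistic algorithm,
the convention of `mem_BPP_iff_randAlg`; the test is fed `⟨1^ℓ, r⟩` but not the seed) and every `c`,
`∃ᶠ ℓ in atTop, |seedAvg c₀ k G T ℓ - unifAvg k T ℓ| < 1/ℓ^c`. -/

end Hyp

/-! ### The distinguisher -/

section Dist

variable (L₁ : Language Bool) (q₁ : Polynomial ℕ) (S : RandAlg ℕ (List Bool)) (qS : Polynomial ℕ) (K k : ℕ)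

/-- The `BPP` predicate `V(x, y) = [⟨x, y⟩ ∈ L₁]`. [cite: AroraBarakCC2009, Def. 7.3] -/
def V (x y : List Bool) : Bool := L₁.boolIndicator (boolPair x y)

/-- **The distinguisher `T`** (Trevisan–Vadhan 2007, proof of Lemma 2.3) for a sampler `S` with exact
coin polynomial `qS`. Input `w = ⟨1^ℓ, r⟩`, coins `c`; with `n = ℓ^K`, `u = c ↾ qS(n)` and `s` the
next `q₁(n)` coins: sample `x = S(1ⁿ; u)` and output `[V(x, r ↾ q₁(n)) ≠ V(x, s)]`. The budget is the
polynomial `(qS + q₁)(N^K)` of the input length `N ≥ ℓ` (enough coins; the surplus is ignored).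
[cite: TrevisanVadhan2007, Lemma 2.3 (proof: the test `T`)] -/
def distinguisher : RandAlg (List Bool) Bool where
  run w c :=
    let n := (fstF w).length ^ K
    let x := S.run n (c.take (qS.eval n))
    V L₁ x (List.takeD (q₁.eval n) (sndF w) false) != V L₁ x ((c.drop (qS.eval n)).take (q₁.eval n))
  coinLen N := ((qS + q₁).comp (X ^ K)).eval N

/-- `T` tosses exactly `(qS + q₁)(N^K)` coins. [folklore] -/
theorem distinguisher_coinLen_eq :
    ∀ N, (distinguisher L₁ q₁ S qS K).coinLen N = ((qS + q₁).comp (X ^ K)).eval N := fun _ => rfl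

/-- The budget on `⟨1^ℓ, r⟩` covers the coins used: `qS(ℓ^K) + q₁(ℓ^K) ≤ T.coinLen |⟨1^ℓ, r⟩|`. [folklore] -/
theorem le_distinguisher_coinLen (ℓ : ℕ) (r : List Bool) :
    qS.eval (ℓ ^ K) + q₁.eval (ℓ ^ K) ≤ (distinguisher L₁ q₁ S qS K).coinLen (boolPair (ones ℓ) r).length := by
  have hℓ : ℓ ^ K ≤ (boolPair (ones ℓ) r).length ^ K :=
    Nat.pow_le_pow_left (by rw [length_boolPair]; simp [ones]; omega) K
  simp only [distinguisher, eval_comp, eval_add, eval_pow, eval_X]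
  exact Nat.add_le_add (TM2Iter.eval_mono qS hℓ) (TM2Iter.eval_mono q₁ hℓ)

/-- The answer of `T` on `⟨1^ℓ, r⟩` with coins `c`. [folklore] -/
theorem distinguisher_run (ℓ : ℕ) (r c : List Bool) :
    (distinguisher L₁ q₁ S qS K).run (boolPair (ones ℓ) r) c =
      (V L₁ (S.run (ℓ ^ K) (c.take (qS.eval (ℓ ^ K)))) (List.takeD (q₁.eval (ℓ ^ K)) r false) !=
        V L₁ (S.run (ℓ ^ K) (c.take (qS.eval (ℓ ^ K)))) ((c.drop (qS.eval (ℓ ^ K))).take (q₁.eval (ℓ ^ K)))) := by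
  have hl : (ones ℓ).length = ℓ := by simp [ones]
  simp only [distinguisher, fstF_boolPair, sndF_boolPair, hl]

/-! #### `T` is probabilistic polynomial time -/

/-- On `z = ⟨w, c⟩`: `1ⁿ`, `n = |w₁|^K`. [folklore] -/
def nUF : List Bool → List Bool := polyFn (X ^ K) ∘ fstF ∘ fstF

/-- On `z`: `1^{qS(n)}`. [folklore] -/
def aUF : List Bool → List Bool := polyFn qS ∘ nUF K

/-- On `z`: `1^{q₁(n)}`. [folklore] -/
def bUF : List Bool → List Bool := polyFn q₁ ∘ nUF K

/-- On `z`: the sampler's coins `u = c ↾ qS(n)`. [folklore] -/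
def uF : List Bool → List Bool := takeFn ∘ fanoutFn (aUF qS K) sndF

/-- On `z`: the fresh coins `s = (c ⇂ qS(n)) ↾ q₁(n)`. [folklore] -/
def sUF : List Bool → List Bool := takeFn ∘ fanoutFn (bUF q₁ K) (dropFn ∘ fanoutFn (aUF qS K) sndF)

/-- On `z`: the sample `x = S(1ⁿ; u)`. [folklore] -/
def xF : List Bool → List Bool := sampleFn S ∘ fanoutFn (nUF K) (uF qS K)

/-- On `z`: the challenge prefix `r ↾ q₁(n)` (padded). [folklore] -/
def rF : List Bool → List Bool := fstF ∘ padTakeFn ∘ fanoutFn (bUF q₁ K) (sndF ∘ fstF)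

/-- On `z`: the bit `V(x, r ↾ q₁(n))`. [folklore] -/
def bit1F : List Bool → List Bool := (fun w => encodeBool (L₁.boolIndicator w)) ∘ fanoutFn (xF S qS K) (rF q₁ K)

/-- On `z`: the bit `V(x, s)`. [folklore] -/
def bit2F : List Bool → List Bool := (fun w => encodeBool (L₁.boolIndicator w)) ∘ fanoutFn (xF S qS K) (sUF q₁ qS K)

/-- **The distinguisher as a string function**: `[V(x, r↾q₁(n)) ≠ V(x, s)]` (exclusive or of the two
bits, by `iteFn`/`notFn`). [cite: TrevisanVadhan2007, Lemma 2.3 (proof)] -/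
def distF : List Bool → List Bool :=
  iteFn (bit1F L₁ q₁ S qS K) (notFn (bit2F L₁ q₁ S qS K)) (bit2F L₁ q₁ S qS K)

variable {L₁ S}

/-- `distF ∈ FP` for `L₁ ∈ P` and a probabilistic polynomial-time sampler.
[cite: AroraBarakCC2009, §1.3 (composition)] -/
theorem distF_mem_FP (hL₁ : L₁ ∈ Classes.P) (hS : S.IsPolyTime unaryEncodeNat id) : distF L₁ q₁ S qS K ∈ FP := by
  have hn : nUF K ∈ FP := comp_mem_FP (polyFn_mem_FP _) (comp_mem_FP fstF_mem_FP fstF_mem_FP)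
  have ha : aUF qS K ∈ FP := comp_mem_FP (polyFn_mem_FP _) hn
  have hb : bUF q₁ K ∈ FP := comp_mem_FP (polyFn_mem_FP _) hn
  have hu : uF qS K ∈ FP := comp_mem_FP takeFn_mem_FP (fanoutFn_mem_FP ha sndF_mem_FP)
  have hs : sUF q₁ qS K ∈ FP :=
    comp_mem_FP takeFn_mem_FP (fanoutFn_mem_FP hb (comp_mem_FP dropFn_mem_FP (fanoutFn_mem_FP ha sndF_mem_FP)))
  have hx : xF S qS K ∈ FP := comp_mem_FP (sampleFn_mem_FP hS) (fanoutFn_mem_FP hn hu)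
  have hr : rF q₁ K ∈ FP :=
    comp_mem_FP fstF_mem_FP (comp_mem_FP padTakeFn_mem_FP (fanoutFn_mem_FP hb (comp_mem_FP sndF_mem_FP fstF_mem_FP)))
  have h1 : bit1F L₁ q₁ S qS K ∈ FP := comp_mem_FP (indicatorFn_mem_FP hL₁) (fanoutFn_mem_FP hx hr)
  have h2 : bit2F L₁ q₁ S qS K ∈ FP := comp_mem_FP (indicatorFn_mem_FP hL₁) (fanoutFn_mem_FP hx hs)
  exact iteFn_mem_FP h1 (notFn_mem_FP h2) h2

variable (L₁ S)

/-- **Value of `distF`**: on `⟨w, c⟩` it is the one-symbol code of `T.run w c`. [folklore] -/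
theorem distF_boolPair (w c : List Bool) :
    distF L₁ q₁ S qS K (boolPair w c) = [(distinguisher L₁ q₁ S qS K).run w c] := by
  have hn : nUF K (boolPair w c) = ones ((fstF w).length ^ K) := by simp [nUF]
  have ha : aUF qS K (boolPair w c) = ones (qS.eval ((fstF w).length ^ K)) := by simp [aUF, hn, ones]
  have hb : bUF q₁ K (boolPair w c) = ones (q₁.eval ((fstF w).length ^ K)) := by simp [bUF, hn, ones]
  have hu : uF qS K (boolPair w c) = c.take (qS.eval ((fstF w).length ^ K)) := by simp [uF, ha, ones]
  have hs : sUF q₁ qS K (boolPair w c) =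
      (c.drop (qS.eval ((fstF w).length ^ K))).take (q₁.eval ((fstF w).length ^ K)) := by
    simp [sUF, ha, hb, ones]
  have hx : xF S qS K (boolPair w c) = S.run ((fstF w).length ^ K) (c.take (qS.eval ((fstF w).length ^ K))) := by
    simp [xF, hn, hu, sampleFn, ones]
  have hr : rF q₁ K (boolPair w c) = List.takeD (q₁.eval ((fstF w).length ^ K)) (sndF w) false := by
    simp [rF, hb, ones]
  have h1 : bit1F L₁ q₁ S qS K (boolPair w c) = [V L₁ (S.run ((fstF w).length ^ K)
      (c.take (qS.eval ((fstF w).length ^ K)))) (List.takeD (q₁.eval ((fstF w).length ^ K)) (sndF w) false)] := by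
    simp [bit1F, hx, hr, V, encodeBool]
  have h2 : bit2F L₁ q₁ S qS K (boolPair w c) = [V L₁ (S.run ((fstF w).length ^ K)
      (c.take (qS.eval ((fstF w).length ^ K))))
        ((c.drop (qS.eval ((fstF w).length ^ K))).take (q₁.eval ((fstF w).length ^ K)))] := by
    simp [bit2F, hx, hs, V, encodeBool]
  rw [distF, iteFn_apply h1]
  simp only [distinguisher]
  split_ifs with hb1
  · rw [notFn_apply h2, hb1]; simp
  · rw [h2, Bool.not_eq_true] at *
    rw [hb1]; simp

variable {L₁ S}

/-- **`T` is probabilistic polynomial time** for `L₁ ∈ P` and a probabilistic polynomial-time sampler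
(`run` by `distF`; the budget is the polynomial `(qS + q₁)(N^K)`, exactly: `distinguisher_coinLen_eq`).
[cite: TrevisanVadhan2007, Lemma 2.3 (proof: "`T` has running time `poly(n)`")] -/
theorem distinguisher_isPolyTime (hL₁ : L₁ ∈ Classes.P) (hS : S.IsPolyTime unaryEncodeNat id) :
    (distinguisher L₁ q₁ S qS K).IsPolyTime id encodeBool := by
  refine ⟨?_, ⟨(qS + q₁).comp (X ^ K), fun N => le_rfl⟩⟩
  obtain ⟨p, M, hM⟩ := distF_mem_FP q₁ qS K hL₁ hS
  refine ⟨p, M, fun z => ?_⟩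
  have := hM (boolPair z.1 z.2)
  rwa [id, distF_boolPair L₁ q₁ S qS K] at this

/-! #### The acceptance probability of `T` -/

/-- Prefix marginal with `take`: `Pr_{c ∈ {0,1}^N}[c ↾ b ∈ E] = Pr_{y ∈ {0,1}^b}[y ∈ E]` (`b ≤ N`).
[cite: AroraBarakCC2009, §7.1] -/
theorem uniformProb_take_prefix {b N : ℕ} (h : b ≤ N) (E : Set (List Bool)) :
    uniformProb N {c | c.take b ∈ E} = uniformProb b E := by
  rw [← uniformProb_takeD_prefix h E]
  refine uniformProb_congr' fun y hy => ?_
  simp only [Set.mem_setOf_eq]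
  rw [List.takeD_eq_take _ (by omega)]

variable (L₁ S)

/-- **The acceptance probability of the distinguisher** on `⟨1^ℓ, r⟩`: the average over the
sampler's coins `u ∈ {0,1}^{qS(n)}` of `Pr_s[V(x_u, r↾q₁(n)) ≠ V(x_u, s)]`, `x_u = S(1ⁿ; u)`,
`n = ℓ^K` (the surplus coins are marginalised). [cite: TrevisanVadhan2007, Lemma 2.3 (proof)] -/
theorem pr_distinguisher (ℓ : ℕ) (r : List Bool) :
    (distinguisher L₁ q₁ S qS K).pr id (boolPair (ones ℓ) r) {true} =
      (∑ u : List.Vector Bool (qS.eval (ℓ ^ K)),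
        uniformProb (q₁.eval (ℓ ^ K))
          {s | V L₁ (S.run (ℓ ^ K) u.toList) (List.takeD (q₁.eval (ℓ ^ K)) r false) ≠
            V L₁ (S.run (ℓ ^ K) u.toList) s}) / 2 ^ qS.eval (ℓ ^ K) := by
  rw [RandAlg.pr_eq_uniformProb, id]
  set a := qS.eval (ℓ ^ K) with ha
  set b := q₁.eval (ℓ ^ K) with hb
  set r' := List.takeD b r false with hr'
  have hab : a + b ≤ (distinguisher L₁ q₁ S qS K).coinLen (boolPair (ones ℓ) r).length :=
    le_distinguisher_coinLen L₁ q₁ S qS K ℓ r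
  -- the answer depends on the first `a + b` coins only
  have h1 : uniformProb ((distinguisher L₁ q₁ S qS K).coinLen (boolPair (ones ℓ) r).length)
      {c | (distinguisher L₁ q₁ S qS K).run (boolPair (ones ℓ) r) c ∈ ({true} : Set Bool)} =
      uniformProb ((distinguisher L₁ q₁ S qS K).coinLen (boolPair (ones ℓ) r).length)
      {c | c.take (a + b) ∈ {y : List Bool | (V L₁ (S.run (ℓ ^ K) (y.take a)) r' !=
        V L₁ (S.run (ℓ ^ K) (y.take a)) (y.drop a)) = true}} := by
    refine uniformProb_congr' fun c _ => ?_
    simp only [Set.mem_setOf_eq, Set.mem_singleton_iff, distinguisher_run, ← ha, ← hb, ← hr', List.take_take,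
      min_eq_left (Nat.le_add_right a b), List.drop_take, Nat.add_sub_cancel_left]
  rw [h1, uniformProb_take_prefix hab, ← uniformProb_split a b
    (fun u s => V L₁ (S.run (ℓ ^ K) u) r' ≠ V L₁ (S.run (ℓ ^ K) u) s)]
  refine uniformProb_congr' fun y _ => ?_
  simp only [Set.mem_setOf_eq]
  exact bne_iff_ne

end Dist

end UDerand

end Literature.Computability.Complexity

end
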